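import Literature.Claims.NS.Vukovic2015
import Literature.Claims.NS.Zhirkin2016
import Literature.Analysis.FluidPDE.ClaySettingParasiticDrift
import HarnessLib

/-!
# C57 `Vukovic2015` (D-0090 NS-CLAIMS SWEEP, T3 QUICK tranche) — Step 1 ((39) p. 123) is false; Step 2 carries nothing

V. A. Vuković, *Existence and smoothness of the Navier–Stokes equation in R³*, IJMNTA 4 (2015) 117–126
(doi:10.4236/ijmnta.2015.42008; bib `Vukovic2015NSR3`). The claimed statement p. 118 is Fefferman's (A) word for
word (`claimedTheorem_iff_clayA : … := Iff.rfl`). The decisive passage p. 123 (PDF p. 7): display (39) — the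
Ricci-flow minimal-sphere inequality `∂ₜW ≤ −4π − ½R_min·W` of Perelman/Tao's notes — is read as «this forces
blow-up in finite time. This means that the solution blows up in a finite time», and then «So the solution must blow
up in some definite [time] … This proves that the solution is existent and smooth.»

Kernel facts (QUICK sentence grain of the skeleton p483727, typist-7 g2):
* `not_Step_blowup39` — Step 1 as typed (EVERY Clay datum's unforced problem has NO global smooth bounded-energy
  solution) is false: the zero datum is a Clay datum and the rest state solves (tree `clayDatum_zero`,
  `Zhirkin2016.clayR3_solvable_zero`); `step_blowup39_fails_at` records this at EVERY viscosity `ν`, not only `ν = 1`.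
* `step_smooth123_holds` — consequently Step 2 (`Step_blowup39 → ClaimedTheorem`) holds VACUOUSLY: the printed
  chain `claim_of_steps` transmits nothing (logic record).
* `not_claimed_of_blowup39some`, `steps_some_inconsistent` — under the charitable reading («SOME solution blows up»,
  `Step_blowup39some` = unforced (C) at every `ν`, an OPEN statement which this file does NOT decide) Step 1 REFUTES
  the claimed statement, so the charitable Steps 1 and 2 cannot both hold; and the skeleton's
  `step_smooth123some_iff_claim` makes charitable Step 2 the claim itself.

Authorship: typist-7 g2's kill kit (sha16 da4ad818e54f5c29) adopted by the refuter of record (refuter-7) with the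
statement types written out in full and one companion (`step_blowup39_fails_at`); filed unchanged by the salvage
seat (cell convention (b)).

WHAT THIS IS NOT: not a claim about NS regularity or blow-up; not a claim about any author beyond
the typed locator.
-/

set_option linter.dupNamespace false

namespace Summit.NavierStokesRegularity.NavierStokesRegularity.Theorems.Vukovic2015

open scoped ContDiff
open Literature.Claims.NS.Vukovic2015 Literature.Analysis.FluidPDE

/-- At EVERY viscosity `ν` (no sign needed) some Clay datum — the zero datum — HAS a global smooth bounded-energy
unforced solution, the rest state `(u, p) = (0, 0)`. [cite: Vukovic2015NSR3, (39) p.123]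
[cite: FeffermanClay2006, (A) (4) (7) p. 1–2] -/
theorem step_blowup39_fails_at (ν : ℝ) :
    ∃ u₀ : EuclideanSpace ℝ (Fin 3) → EuclideanSpace ℝ (Fin 3),
      ContDiff ℝ ∞ u₀ ∧ NSWave0.IsDivFree u₀ ∧ HasRapidSpatialDecay u₀ ∧
        Literature.Claims.NS.ClayVariants.clayR3.Solvable ν 0 u₀ := by
  obtain ⟨h0, hdiv, hdec⟩ := clayDatum_zero
  exact ⟨0, h0, hdiv, hdec, Literature.Claims.NS.Zhirkin2016.clayR3_solvable_zero ν⟩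

/-- **Step 1 fails** ((39) p. 123 / PDF p. 7, «the solution blows up in a finite time», typed at the claimed class):
at `ν = 1` the zero datum (smooth, divergence free, rapidly decaying) has the global smooth bounded-energy solution
`(u, p) = (0, 0)`. [claim: Vukovic2015NSR3, status: disputed] -/
theorem not_Step_blowup39 : ¬ Literature.Claims.NS.Vukovic2015.Step_blowup39 := by
  intro h
  obtain ⟨u₀, h0, hdiv, hdec, hsol⟩ := step_blowup39_fails_at 1
  exact h 1 one_pos u₀ h0 hdiv hdec hsol

/-- **Step 2 holds vacuously** (p. 123 «This proves that the solution is existent and smooth», typed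
`Step_blowup39 → ClaimedTheorem`): its antecedent is false, so the printed chain carries nothing.
[cite: Vukovic2015NSR3, p.123] -/
theorem step_smooth123_holds : Literature.Claims.NS.Vukovic2015.Step_smooth123 :=
  step_smooth123_of_not_blowup39 not_Step_blowup39

/-- **Charitable Step 1 refutes the claim**: a Clay datum without a global smooth bounded-energy solution at `ν = 1`
contradicts the claimed statement (= Clay (A)) at `ν = 1`. Pure logic; `Step_blowup39some` itself (unforced (C) at
every `ν`) is NOT decided here. [cite: Vukovic2015NSR3, (39) p.123 with p.118] -/
theorem not_claimed_of_blowup39some (h : Literature.Claims.NS.Vukovic2015.Step_blowup39some) :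
    ¬ Literature.Claims.NS.Vukovic2015.ClaimedTheorem := by
  intro hA
  obtain ⟨u₀, hu₀, hdiv, hdec, hno⟩ := h 1 one_pos
  exact hno (hA 1 one_pos u₀ hu₀ hdiv hdec)

/-- **The charitable pair is inconsistent**: charitable Steps 1 and 2 cannot both hold (`claim_of_steps_some` gives
the claim, `not_claimed_of_blowup39some` its negation). [cite: Vukovic2015NSR3, p.123] -/
theorem steps_some_inconsistent :
    ¬ (Literature.Claims.NS.Vukovic2015.Step_blowup39some ∧ Literature.Claims.NS.Vukovic2015.Step_smooth123some) :=
  fun ⟨h1, h2⟩ => not_claimed_of_blowup39some h1 (claim_of_steps_some h1 h2)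

end Summit.NavierStokesRegularity.NavierStokesRegularity.Theorems.Vukovic2015
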